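import Summits.FinalStateConjecture.FinalStateConjecture.Theorems.StarvedNecksGapDecaySufficesStubAnchoredLocationV2
import Summits.FinalStateConjecture.FinalStateConjecture.Theorems.StarvedNecksGapDecaySufficesRelabelEach

/-!
# Stub `stub_assembly` (S5 of line `Sketch`, crux `GapDecaySuffices`, skeleton v8) — file 1/2: DEFINITIONS

Verbatim copies of the skeleton's bundles consumed by the reduction of `stub_assembly` (a Theorems file
cannot import `Cruxes`): `GapCertificateAt`, `GapBootstrap`, `flatOnHole`, `FlatFarCertified`,
`pullbackMinus`, `SwitchOffInward`, `FlatTubesClosed`, `NeckCertificate`, `WeakCertificateAfterRelabelling`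
(`HonestCore`, `HonestFar`, `DistinctVelocities`, `TubeAnchoredR` are the landed copies of
`…StubAnchoredLocationV2`, p145261; S4's v8 `AnchoredLocationP` is the landed
`…Location.AnchoredP.AnchoredLocationP`, p166857, imported by file 2/2), the v8 `LabelMatching` (with
`d'.N = d.N` — the wave-1 assembly finding — and eventually non-negative excisions of the output), and the
shapes shared by the three sub-statements of file 2/2 (`…StubAssembly.lean`): `GapCert` (G0–G5 for given data), `Located` (S4's conclusion shape on a window
`[lo·ρ', hi·ρ']`), `AdmissibleProfile`, `SingleHoleCert` (the single-hole clauses of `NeckCertificate` for a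
parity-relabelled hole, plus inner location and coverage).  No `sorry`, standard axioms.
-/
noncomputable section

open scoped Manifold ContDiff Topology ENNReal
open Filter Set Topology Literature.Geometry.Lorentzian

namespace Summit.FinalStateConjecture.FinalStateConjecture.Theorems.GapDecaySuffices.Assembly

-- justified lint debt: the problem namespace repeats the summit name (`FinalStateConjecture.FinalStateConjecture`)
set_option linter.dupNamespace false

open Location.AnchoredV2 (HonestCore HonestFar DistinctVelocities TubeAnchoredR)
open Relabel (ParityDatum relabelMotion relabelChart relabelEach)

/-! ## The skeleton's bundles (verbatim copies; a Theorems file cannot import `Cruxes`) -/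

/-- Gap certificate of hole `i` above the wall profile `w` (verbatim the skeleton's `GapCertificateAt`). -/
def GapCertificateAt (𝓢 : Spacetime.{0} 4) (O : Set 𝓢.carrier) (d : FinalStateDecomposition 𝓢 O 4)
    (R₀ : ℝ) (i : Fin d.N) (w : ℝ → ℝ) : Prop :=
  ∃ (R₁ τ₁ : ℝ) (W : ℝ → ℝ) (Ψg : (d.background i).domain → 𝓢.carrier),
    let B := d.background i; let t := B.time; let r := B.radius;
    R₀ ≤ R₁ ∧ d.τ₀ ≤ τ₁ ∧ Continuous W ∧ (∀ s, τ₁ ≤ s → w s ≤ W s) ∧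
    (let U : Set B.domain := {x | τ₁ < t x.1 ∧ r x.1 < W (x.1 0) + 1};
      ContMDiffOn 𝓘(ℝ, E4) (𝓡 4) ∞ Ψg U ∧ Topology.IsOpenEmbedding (U.restrict Ψg) ∧ Ψg '' U ⊆ d.charted) ∧
    (∀ x : B.domain, r x.1 ≤ R₁ + 1 → Ψg x = d.chart i x) ∧
    Tendsto (fun τ ↦ supCkENorm (Subtype.val '' {x : B.domain | t x.1 = τ ∧ r x.1 ≤ W (x.1 0)}) 2
      (𝓢.deviationExtend B Ψg)) atTop (𝓝 0) ∧
    (∀ x : B.domain, τ₁ ≤ t x.1 → R₁ ≤ r x.1 → r x.1 ≤ W (x.1 0) →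
      𝓢.timeOrientation.IsFutureDirected
        (mfderiv 𝓘(ℝ, E4) (𝓡 4) Ψg x (((d.motion i).1 : E4 ≃L[ℝ] E4) (E4.basisVector 0)))) ∧
    (∀ (τ' : ℝ) (ϱ : ℝ → ℝ), Continuous ϱ → τ₁ < τ' →
      (∀ x : B.domain, τ' ≤ t x.1 → r x.1 ≤ ϱ (t x.1) → r x.1 ≤ W (x.1 0)) →
      closure (Ψg '' {x | τ' ≤ t x.1 ∧ r x.1 ≤ ϱ (t x.1)}) ∩ O ⊆ Ψg '' {x | τ' ≤ t x.1 ∧ r x.1 ≤ ϱ (t x.1)})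

/-- (S1) Gap bootstrap (verbatim the skeleton's `GapBootstrap`). -/
def GapBootstrap : Prop :=
  ∀ (X : Type) [TopologicalSpace X] [ChartedSpace E3 X] [IsManifold (𝓡 3) ∞ X] [ConnectedSpace X]
    (D : InitialDataSet (𝓡 3) X), D ∈ admissibleVacuumData X →
    ∀ 𝒟 : VacuumCauchyDevelopment D, 𝒟.IsMaximal →
    ∀ (O : Set 𝒟.carrier) (d : FinalStateDecomposition 𝒟.toSpacetime O 4) (R₀ : ℝ),
      O = exteriorOf 𝒟.toCauchyDevelopment d.charted →
      HonestCore 𝒟.toSpacetime O 4 d R₀ → HonestFar 𝒟.toSpacetime O 4 d R₀ →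
      DistinctVelocities 𝒟.toSpacetime O 4 d →
      ∀ (i : Fin d.N) (ρ' : ℝ → ℝ) (τm : ℝ), (∀ s, τm ≤ s → d.excision i s ≤ ρ' s) →
        Tendsto (fun s ↦ ρ' s / s) atTop (𝓝 0) →
        GapCertificateAt 𝒟.toSpacetime O d R₀ i (fun s ↦ 3 * ρ' s + 2)

/-- The input flat chart transported to hole `i`'s model domain (verbatim the skeleton's `flatOnHole`). -/
def flatOnHole {𝓢 : Spacetime.{0} 4} {O : Set 𝓢.carrier} {k : ℕ} (d : FinalStateDecomposition 𝓢 O k)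
    (i : Fin d.N) (x : (d.background i).domain) : 𝓢.carrier :=
  open scoped Classical in
  if h : x.1 ∈ d.flatDomain then d.flatChart ⟨x.1, h⟩ else d.chart i x

/-- (S2) Far certification of the input flat chart (verbatim the skeleton's `FlatFarCertified`). -/
def FlatFarCertified : Prop :=
  ∀ (𝓢 : Spacetime.{0} 4) (O : Set 𝓢.carrier) (d : FinalStateDecomposition 𝓢 O 4) (i : Fin d.N)
    (σ σ' m : ℝ → ℝ) (τ₂ : ℝ),
    Kerr.IsSubextremal (d.mass i) (d.spin i) →
    Tendsto σ atTop atTop → Tendsto m atTop atTop →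
    (∀ x : (d.background i).domain, τ₂ ≤ (d.background i).time x.1 →
      σ ((d.background i).time x.1) ≤ (d.background i).radius x.1 →
      (d.background i).radius x.1 ≤ σ' ((d.background i).time x.1) →
        m ((d.background i).time x.1) ≤ x.1 0 ∧ d.τ₀ < x.1 0 ∧
          ∀ j, d.excision j (x.1 0) + 1 ≤ (d.background j).radius x.1) →
    Tendsto (fun τ ↦ supCkENorm
      (Subtype.val '' {x : (d.background i).domain | (d.background i).time x.1 = τ ∧
        σ τ ≤ (d.background i).radius x.1 ∧ (d.background i).radius x.1 ≤ σ' τ}) 2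
      (𝓢.deviationExtend (d.background i) (flatOnHole d i))) atTop (𝓝 0)

/-- `(T^* g − g₀)(x) = g(T x)(DT x ·, DT x ·) − g₀ x` (verbatim the skeleton's `pullbackMinus`). -/
def pullbackMinus (g : E4 → E4 →L[ℝ] E4 →L[ℝ] ℝ) (T : E4 → E4) (g₀ : E4 → E4 →L[ℝ] E4 →L[ℝ] ℝ)
    (x : E4) : E4 →L[ℝ] E4 →L[ℝ] ℝ :=
  (g (T x)).bilinearComp (fderiv ℝ T x) (fderiv ℝ T x) - g₀ x

/-- (S3, two-metric form, v3) Inward switch-off (verbatim the skeleton's `SwitchOffInward`). -/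
def SwitchOffInward : Prop :=
  ∀ (τA : ℝ) (rin σ κ : ℝ → ℝ) (T : E4 → E4) (h₁ h₂ Bm : E4 → E4 →L[ℝ] E4 →L[ℝ] ℝ),
    ContDiff ℝ ∞ rin → ContDiff ℝ ∞ σ →
    (∀ τ, |deriv rin τ| ≤ 1 ∧ |deriv σ τ| ≤ 1 ∧ 1 ≤ rin τ ∧ rin τ ≤ σ τ) →
    Tendsto (fun τ ↦ σ τ / rin τ) atTop atTop →
    Tendsto κ atTop (𝓝 0) →
    ContDiffOn ℝ ∞ (fun p : E4 × E4 ↦ Bm p.1 p.2)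
      ({y | τA < y 0 ∧ rin (y 0) / 2 < E4.spatialNorm y} ×ˢ univ) →
    ContDiffOn ℝ ∞ (fun p : E4 × E4 ↦ h₂ p.1 p.2)
      ({y | τA < y 0 ∧ rin (y 0) / 2 < E4.spatialNorm y} ×ˢ univ) →
    (let 𝒞 : Set E4 :=
        {x | τA < x 0 ∧ 3 / 4 * σ (x 0) < E4.spatialNorm x ∧ E4.spatialNorm x < 7 / 4 * σ (x 0)};
      let 𝒯 : Set E4 := {y | τA < y 0 ∧ E4.spatialNorm y < 2 * σ (y 0)};
      ContDiffOn ℝ ∞ T 𝒞 ∧ InjOn T 𝒞 ∧ MapsTo T 𝒞 𝒯 ∧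
      (∀ x ∈ 𝒞, 0 < LinearMap.det (fderiv ℝ T x : E4 →ₗ[ℝ] E4) ∧ 0 < fderiv ℝ T x (E4.basisVector 0) 0) ∧
      (∀ x ∈ 𝒞, |E4.spatialNorm (T x) - E4.spatialNorm x| ≤ κ (x 0) * σ (x 0) ∧
        |T x 0 - x 0| ≤ κ (x 0) * σ (x 0)) ∧
      (∀ x ∈ 𝒞, ∀ v w : E4,
        (Bm (T x) + h₂ (T x)) (fderiv ℝ T x v) (fderiv ℝ T x w) = (Minkowski.bilin + h₁ x) v w) ∧
      Tendsto (fun τ ↦ supCkENorm {x | x ∈ 𝒞 ∧ x 0 = τ} 2 h₁) atTop (𝓝 0) ∧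
      Tendsto (fun τ ↦ supCkENorm {y | y ∈ 𝒯 ∧ y 0 = τ} 2 h₂) atTop (𝓝 0) ∧
      Tendsto (fun τ ↦ supCkENorm {y | y ∈ 𝒯 ∧ y 0 = τ ∧ rin τ / 2 ≤ E4.spatialNorm y} 2
        (fun y ↦ Bm y - Minkowski.bilin)) atTop (𝓝 0)) →
    ∃ (τA' : ℝ) (κ' : ℝ → ℝ) (S : E4 → E4),
      let 𝒵 : Set E4 := {x | τA' < x 0 ∧ E4.spatialNorm x < 7 / 4 * σ (x 0)};
      let 𝒯 : Set E4 := {y | τA < y 0 ∧ E4.spatialNorm y < 2 * σ (y 0)};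
      τA ≤ τA' ∧ Tendsto κ' atTop (𝓝 0) ∧
      ContDiffOn ℝ ∞ S 𝒵 ∧ InjOn S 𝒵 ∧ IsOpenMap (𝒵.restrict S) ∧ MapsTo S 𝒵 𝒯 ∧
      (∀ x ∈ 𝒵, E4.spatialNorm x ≤ rin (x 0) → S x = x) ∧
      (∀ x ∈ 𝒵, 3 / 2 * σ (x 0) ≤ E4.spatialNorm x → S x = T x) ∧
      (∀ x ∈ 𝒵, |E4.spatialNorm (S x) - E4.spatialNorm x| ≤ κ' (x 0) * σ (x 0) ∧
        |S x 0 - x 0| ≤ κ' (x 0) * σ (x 0)) ∧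
      Tendsto (fun τ ↦ supCkENorm {x | x ∈ 𝒵 ∧ x 0 = τ} 2
        (pullbackMinus (fun y ↦ Bm y + h₂ y) S Bm)) atTop (𝓝 0)

/-- **Label matching** (verbatim the skeleton v8 `LabelMatching`): every honest `C⁴` input with distinct
velocities can be relabelled into an honest, radius-anchored input with the same charted region, the same
number of holes (`d'.N = d.N`, the wave-1 assembly finding: without it `0 < d'.N` cannot be delivered), the
same flat chart / flat domain, and eventually non-negative excision radii (the non-degenerate anchoring
window S4 needs, v8). -/
def LabelMatching : Prop :=
  ∀ (X : Type) [TopologicalSpace X] [ChartedSpace E3 X] [IsManifold (𝓡 3) ∞ X] [ConnectedSpace X]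
    (D : InitialDataSet (𝓡 3) X), D ∈ admissibleVacuumData X →
    ∀ 𝒟 : VacuumCauchyDevelopment D, 𝒟.IsMaximal →
    ∀ (O : Set 𝒟.carrier) (d : FinalStateDecomposition 𝒟.toSpacetime O 4) (R₀ : ℝ),
      O = exteriorOf 𝒟.toCauchyDevelopment d.charted →
      HonestCore 𝒟.toSpacetime O 4 d R₀ → HonestFar 𝒟.toSpacetime O 4 d R₀ →
      DistinctVelocities 𝒟.toSpacetime O 4 d →
      ∃ (d' : FinalStateDecomposition 𝒟.toSpacetime O 4) (R₀' : ℝ),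
        d'.charted = d.charted ∧ d'.N = d.N ∧ d'.flatDomain = d.flatDomain ∧
          (∀ (y : E4) (hy : y ∈ d.flatDomain) (hy' : y ∈ d'.flatDomain),
            d'.flatChart ⟨y, hy'⟩ = d.flatChart ⟨y, hy⟩) ∧
          HonestCore 𝒟.toSpacetime O 4 d' R₀' ∧ HonestFar 𝒟.toSpacetime O 4 d' R₀' ∧
          DistinctVelocities 𝒟.toSpacetime O 4 d' ∧ TubeAnchoredR d' R₀' ∧
          (∀ i, ∀ᶠ s in atTop, 0 ≤ d'.excision i s)

/-- `FlatTubesClosed` = the crux's `Hf`(2) alone (verbatim the skeleton's). -/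
def FlatTubesClosed (𝓢 : Spacetime.{0} 4) (O : Set 𝓢.carrier) (k : ℕ) (d : FinalStateDecomposition 𝓢 O k) :
    Prop :=
  ∀ τ' : ℝ, d.τ₀ < τ' →
    closure (d.flatChart '' {y | τ' ≤ y.1 0 ∧ ∀ i, d.excision i (y.1 0) + 1 ≤ (d.background i).radius y.1}) ⊆
      d.flatChart '' {y | τ' ≤ y.1 0}

/-- `NeckCertificate` = K1–K12 of the v5 skeleton (verbatim the skeleton's). -/
def NeckCertificate (𝓢 : Spacetime.{0} 4) (O : Set 𝓢.carrier) (d : FinalStateDecomposition 𝓢 O 4)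
    (R₀ : ℝ) : Prop :=
  let B := d.background; let t := fun i ↦ (B i).time; let r := fun i ↦ (B i).radius
  let Λ := fun i ↦ ((d.motion i).1 : E4 ≃L[ℝ] E4); let Φ := d.flatChart; let Ψ := d.chart
  let ρ := d.excision
  ∃ (R₁ τ₁ : ℝ) (ρa Rc : Fin d.N → ℝ → ℝ) (Ψa : ∀ i, (B i).domain → 𝓢.carrier),
    R₀ ≤ R₁ ∧ d.τ₀ ≤ τ₁ ∧
    (∀ i, Monotone (ρa i) ∧ Continuous (ρa i) ∧ Tendsto (fun s ↦ ρa i s / s) atTop (𝓝 0) ∧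
      Tendsto (ρa i) atTop atTop ∧ ∀ s, R₁ + 1 ≤ ρa i s ∧ (τ₁ ≤ s → ρ i s + 1 ≤ ρa i s)) ∧
    (∀ i, Monotone (Rc i) ∧ Continuous (Rc i) ∧ Tendsto (fun s ↦ Rc i s / s) atTop (𝓝 0) ∧
      Tendsto (Rc i) atTop atTop ∧ ∀ s, R₁ + 4 ≤ Rc i s) ∧
    (∀ j (y : E4), τ₁ ≤ y 0 → r j y ≤ 9 * ρa j (y 0) → r j y + 3 ≤ Rc j (t j y)) ∧
    (∀ i, let U : Set (B i).domain := {x | τ₁ < t i x.1 ∧ r i x.1 < Rc i (t i x.1) + 2}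
      ContMDiffOn 𝓘(ℝ, E4) (𝓡 4) ∞ (Ψa i) U ∧ IsOpenEmbedding (U.restrict (Ψa i)) ∧
        Ψa i '' U ⊆ d.charted) ∧
    (∀ i (x : (B i).domain), r i x.1 ≤ R₁ + 1 → Ψa i x = Ψ i x) ∧
    (∀ i (y : E4) (hy : y ∈ (B i).domain), τ₁ ≤ y 0 → 4 * ρa i (y 0) ≤ r i y →
      r i y ≤ Rc i (t i y) + 2 → ∃ hy' : y ∈ d.flatDomain, Ψa i ⟨y, hy⟩ = Φ ⟨y, hy'⟩) ∧
    (∀ i, Tendsto (fun τ ↦ 𝓢.truncDeviationCk (B i) (Ψa i) 2 (Rc i τ) τ) atTop (𝓝 0)) ∧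
    (∀ i, supCkENorm (Subtype.val '' {x : (B i).domain | τ₁ ≤ t i x.1 ∧ R₁ ≤ r i x.1 ∧
        r i x.1 ≤ Rc i (t i x.1) + 2}) 0 (𝓢.deviationExtend (B i) (Ψa i)) ≤
      ENNReal.ofReal (1 / (10 * ‖(Λ i : E4 →L[ℝ] E4)‖ ^ 2))) ∧
    (∀ i (x : (B i).domain), τ₁ ≤ t i x.1 → R₁ ≤ r i x.1 → r i x.1 ≤ Rc i (t i x.1) + 2 →
      𝓢.timeOrientation.IsFutureDirected
        (mfderiv 𝓘(ℝ, E4) (𝓡 4) (Ψa i) x ((Λ i) (E4.basisVector 0)))) ∧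
    (∀ i j, i ≠ j → Disjoint (Ψa i '' {x | τ₁ < t i x.1 ∧ r i x.1 < Rc i (t i x.1) + 2})
      (Ψa j '' {x | τ₁ < t j x.1 ∧ r j x.1 < Rc j (t j x.1) + 2})) ∧
    (∀ i (τ' : ℝ) (ϱ : ℝ → ℝ), Continuous ϱ → τ₁ < τ' → (∀ s, ϱ s < Rc i s + 2) →
      closure (Ψa i '' {x | τ' ≤ t i x.1 ∧ r i x.1 ≤ ϱ (t i x.1)}) ∩ O ⊆
        Ψa i '' {x | τ' ≤ t i x.1 ∧ r i x.1 ≤ ϱ (t i x.1)}) ∧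
    (∀ (T : ℝ) (Th : Fin d.N → ℝ), τ₁ < T → (∀ j, τ₁ < Th j) →
      (∀ j (y : E4), T < y 0 → r j y ≤ Rc j (t j y) + 2 → Th j < t j y) →
      O \ (Φ '' {y | T < y.1 0 ∧ ∀ j, 5 * ρa j (y.1 0) < r j y.1} ∪
          ⋃ j, Ψa j '' {x | Th j < t j x.1 ∧ r j x.1 < Rc j (t j x.1) + 2}) ⊆
        𝓢.metric.causalPast 𝓢.timeOrientation
          (Φ '' {y | y.1 0 = T ∧ ∀ j, 5 * ρa j (y.1 0) < r j y.1} ∪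
            ⋃ j, Ψa j '' {x | t j x.1 = Th j ∧ r j x.1 < Rc j (t j x.1) + 2}))

/-- Certificate after relabelling, parity-safe form (verbatim the skeleton's `WeakCertificateAfterRelabelling`). -/
def WeakCertificateAfterRelabelling : Prop :=
  ∀ (X : Type) [TopologicalSpace X] [ChartedSpace E3 X] [IsManifold (𝓡 3) ∞ X] [ConnectedSpace X]
    (D : InitialDataSet (𝓡 3) X), D ∈ admissibleVacuumData X →
    ∀ 𝒟 : VacuumCauchyDevelopment D, 𝒟.IsMaximal →
    ∀ (O : Set 𝒟.carrier) (d : FinalStateDecomposition 𝒟.toSpacetime O 4) (R₀ : ℝ),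
      O = exteriorOf 𝒟.toCauchyDevelopment d.charted →
      HonestCore 𝒟.toSpacetime O 4 d R₀ → HonestFar 𝒟.toSpacetime O 4 d R₀ →
      DistinctVelocities 𝒟.toSpacetime O 4 d →
      (∀ (i : Fin d.N) (ρ' : ℝ → ℝ) (τm : ℝ), (∀ s, τm ≤ s → d.excision i s ≤ ρ' s) →
        Tendsto (fun s ↦ ρ' s / s) atTop (𝓝 0) →
        GapCertificateAt 𝒟.toSpacetime O d R₀ i (fun s ↦ 3 * ρ' s + 2)) →
      0 < d.N →
      ∃ (d' : FinalStateDecomposition 𝒟.toSpacetime O 4) (R₀' : ℝ),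
        d'.charted = d.charted ∧ 0 < d'.N ∧ HonestCore 𝒟.toSpacetime O 4 d' R₀' ∧
          FlatTubesClosed 𝒟.toSpacetime O 4 d' ∧ DistinctVelocities 𝒟.toSpacetime O 4 d' ∧
          NeckCertificate 𝒟.toSpacetime O d' R₀'

/-! ## Shapes shared by the three sub-statements -/

/-- G0–G5 of a gap certificate of hole `i` above `w`, for GIVEN data `(R₁, τ₁, W, Ψg)` (the body of
`GapCertificateAt` after its existential; `GapCertificateAt … w ↔ ∃ R₁ τ₁ W Ψg, GapCert … w R₁ τ₁ W Ψg`
is `Iff.rfl`). -/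
def GapCert {𝓢 : Spacetime.{0} 4} {O : Set 𝓢.carrier} (d : FinalStateDecomposition 𝓢 O 4) (R₀ : ℝ)
    (i : Fin d.N) (w : ℝ → ℝ) (R₁ τ₁ : ℝ) (W : ℝ → ℝ) (Ψg : (d.background i).domain → 𝓢.carrier) : Prop :=
  let B := d.background i; let t := B.time; let r := B.radius;
  R₀ ≤ R₁ ∧ d.τ₀ ≤ τ₁ ∧ Continuous W ∧ (∀ s, τ₁ ≤ s → w s ≤ W s) ∧
  (let U : Set B.domain := {x | τ₁ < t x.1 ∧ r x.1 < W (x.1 0) + 1};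
    ContMDiffOn 𝓘(ℝ, E4) (𝓡 4) ∞ Ψg U ∧ Topology.IsOpenEmbedding (U.restrict Ψg) ∧ Ψg '' U ⊆ d.charted) ∧
  (∀ x : B.domain, r x.1 ≤ R₁ + 1 → Ψg x = d.chart i x) ∧
  Tendsto (fun τ ↦ supCkENorm (Subtype.val '' {x : B.domain | t x.1 = τ ∧ r x.1 ≤ W (x.1 0)}) 2
    (𝓢.deviationExtend B Ψg)) atTop (𝓝 0) ∧
  (∀ x : B.domain, τ₁ ≤ t x.1 → R₁ ≤ r x.1 → r x.1 ≤ W (x.1 0) →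
    𝓢.timeOrientation.IsFutureDirected
      (mfderiv 𝓘(ℝ, E4) (𝓡 4) Ψg x (((d.motion i).1 : E4 ≃L[ℝ] E4) (E4.basisVector 0)))) ∧
  (∀ (τ' : ℝ) (ϱ : ℝ → ℝ), Continuous ϱ → τ₁ < τ' →
    (∀ x : B.domain, τ' ≤ t x.1 → r x.1 ≤ ϱ (t x.1) → r x.1 ≤ W (x.1 0)) →
    closure (Ψg '' {x | τ' ≤ t x.1 ∧ r x.1 ≤ ϱ (t x.1)}) ∩ O ⊆ Ψg '' {x | τ' ≤ t x.1 ∧ r x.1 ≤ ϱ (t x.1)})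

/-- `GapCertificateAt` is `∃ data, GapCert data`. -/
theorem gapCertificateAt_iff {𝓢 : Spacetime.{0} 4} {O : Set 𝓢.carrier}
    (d : FinalStateDecomposition 𝓢 O 4) (R₀ : ℝ) (i : Fin d.N) (w : ℝ → ℝ) :
    GapCertificateAt 𝓢 O d R₀ i w ↔ ∃ (R₁ τ₁ : ℝ) (W : ℝ → ℝ)
      (Ψg : (d.background i).domain → 𝓢.carrier), GapCert d R₀ i w R₁ τ₁ W Ψg :=
  Iff.rfl

/-- **Location of the flat collar `lo·ρ'(y⁰) ≤ rᵢ y ≤ hi·ρ'(y⁰)` in the gap chart** (the shape of S4's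
conclusion, which is `∃ τ₂ κ, τ₁ ≤ τ₂ ∧ κ → 0 ∧ Located d i ρ' τ₁ W Ψg τ₂ κ (11/10) (29/10)`): after hole
time `τ₂` every such coordinate point is late-flat off every excised tube with margin `1`, and its flat
image is `Ψg x` for a gap-tube point `x` whose hole clock and radius are within `κ(tᵢ y)·ρ'(y⁰)` of `y`'s. -/
def Located {𝓢 : Spacetime.{0} 4} {O : Set 𝓢.carrier} (d : FinalStateDecomposition 𝓢 O 4) (i : Fin d.N)
    (ρ' : ℝ → ℝ) (τ₁ : ℝ) (W : ℝ → ℝ) (Ψg : (d.background i).domain → 𝓢.carrier) (τ₂ : ℝ) (κ : ℝ → ℝ)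
    (lo hi : ℝ) : Prop :=
  let B := d.background i; let t := B.time; let r := B.radius;
  ∀ (y : E4) (hy : y ∈ B.domain), τ₂ < t y → lo * ρ' (y 0) ≤ r y → r y ≤ hi * ρ' (y 0) →
    ∃ hy' : y ∈ d.flatDomain, d.τ₀ < y 0 ∧
      (∀ j, d.excision j (y 0) + 1 ≤ (d.background j).radius y) ∧
      ∃ x : B.domain, τ₁ < t x.1 ∧ r x.1 < W (x.1 0) ∧ Ψg x = d.flatChart ⟨y, hy'⟩ ∧
        |t x.1 - t y| ≤ κ (t y) * ρ' (y 0) ∧ |r x.1 - r y| ≤ κ (t y) * ρ' (y 0)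

/-- **Admissible analysis profile of hole `i`**: `ρ'` is smooth, non-decreasing, concave on `[0, ∞)`,
sublinear, unbounded, of slope `≤ 1/(4γᵢ)` (`γᵢ = (Λᵢ∂₀)⁰`, so that the hole-time profile `2ρ'(γᵢ t)`
is `1`-Lipschitz), above the floor `R₀ + 2 + |aᵢ|` and `1`, and above `ρᵢ + 1` from `τm` on. -/
def AdmissibleProfile {𝓢 : Spacetime.{0} 4} {O : Set 𝓢.carrier} (d : FinalStateDecomposition 𝓢 O 4)
    (R₀ : ℝ) (i : Fin d.N) (ρ' : ℝ → ℝ) (τm : ℝ) : Prop :=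
  ContDiff ℝ ∞ ρ' ∧ Monotone ρ' ∧ ConcaveOn ℝ (Set.Ici 0) ρ' ∧
    Tendsto (fun s ↦ ρ' s / s) atTop (𝓝 0) ∧ Tendsto ρ' atTop atTop ∧
    (∀ s, 4 * ((d.motion i).1 : E4 ≃L[ℝ] E4) (E4.basisVector 0) 0 * |deriv ρ' s| ≤ 1) ∧
    (∀ s, R₀ + 2 + |d.spin i| ≤ ρ' s ∧ 1 ≤ ρ' s) ∧
    (∀ s, τm ≤ s → d.excision i s + 1 ≤ ρ' s)

/-- **Single-hole certificate of the `P`-relabelled hole `i`** — the clauses of `NeckCertificate` that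
mention one hole only, for the relabelled label `(Λᵢ P.Q, cᵢ)` with hole chart `Ψᵢ ∘ Q̃` (=
`(relabelEach d P').background i`, `.chart i` definitionally whenever `P' i = P`), with `R₁ := R₀`,
`ρa := ρ'`, late time `τn`, certified radius `Rc` and re-gauged chart `Ψa`: K1' `τ₀ ≤ τn`; K2 floor /
excision domination; K3' (`Rc` monotone, continuous, sublinear, `→ ∞`, `≥ R₀ + 4`); K3; K4 (smooth open
embedding of the late tube `U = {τn < t, r < Rc + 2}` into `d.charted`); K6 (`Ψa = Ψᵢ ∘ Q̃` inside
`R₀ + 1`); K7 (one atlas with the flat chart from `4ρ'` on); K8 (`C²` certification out to `Rc`); K9 (`C⁰`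
honesty from `R₀`) and future `Λᵢ∂₀`-lines from `R₀`; K11 (relative closedness in `O` of the late
sub-`Rc + 2` tube portions) — PLUS what the cross-hole bookkeeping needs and only the construction knows:
INNER LOCATION (every late point of the tube with `r ≤ 4ρ'(x⁰)` is mapped by `Ψa` to the `Ψg`-image of a
gap-tube point with clock and radius within `κ'(t)ρ'(x⁰)`, `κ' → 0`) and COVERAGE (`r < Rc(t) + 2` forces
`r ≤ 40ρ'(x⁰)`: the whole tube lies in the located range of the flat collar). -/
def SingleHoleCert {𝓢 : Spacetime.{0} 4} {O : Set 𝓢.carrier} (d : FinalStateDecomposition 𝓢 O 4)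
    (R₀ : ℝ) (i : Fin d.N) (P : ParityDatum (d.motion i).1) (ρ' : ℝ → ℝ) (τ₁ : ℝ) (W : ℝ → ℝ)
    (Ψg : (d.background i).domain → 𝓢.carrier) (τn : ℝ) (Rc κ' : ℝ → ℝ)
    (Ψa : (boostedKerrBackground (relabelMotion P) (d.motion i).2 (d.mass i) (d.spin i)).domain →
      𝓢.carrier) : Prop :=
  let B := boostedKerrBackground (relabelMotion P) (d.motion i).2 (d.mass i) (d.spin i)
  let t := B.time; let r := B.radius
  let Λ := ((relabelMotion P : lorentzGroup) : E4 ≃L[ℝ] E4)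
  let Ψ := relabelChart P (d.motion i).2 (d.mass i) (d.spin i) (d.chart i)
  let Φ := d.flatChart; let ρ := d.excision i
  let t₀ := (d.background i).time; let r₀ := (d.background i).radius
  d.τ₀ ≤ τn ∧ Tendsto κ' atTop (𝓝 0) ∧
  (∀ s, R₀ + 1 ≤ ρ' s ∧ (τn ≤ s → ρ s + 1 ≤ ρ' s)) ∧
  (Monotone Rc ∧ Continuous Rc ∧ Tendsto (fun s ↦ Rc s / s) atTop (𝓝 0) ∧
    Tendsto Rc atTop atTop ∧ ∀ s, R₀ + 4 ≤ Rc s) ∧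
  (∀ y : E4, τn ≤ y 0 → r y ≤ 9 * ρ' (y 0) → r y + 3 ≤ Rc (t y)) ∧
  (let U : Set B.domain := {x | τn < t x.1 ∧ r x.1 < Rc (t x.1) + 2};
    ContMDiffOn 𝓘(ℝ, E4) (𝓡 4) ∞ Ψa U ∧ IsOpenEmbedding (U.restrict Ψa) ∧ Ψa '' U ⊆ d.charted) ∧
  (∀ x : B.domain, r x.1 ≤ R₀ + 1 → Ψa x = Ψ x) ∧
  (∀ (y : E4) (hy : y ∈ B.domain), τn ≤ y 0 → 4 * ρ' (y 0) ≤ r y → r y ≤ Rc (t y) + 2 →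
    ∃ hy' : y ∈ d.flatDomain, Ψa ⟨y, hy⟩ = Φ ⟨y, hy'⟩) ∧
  Tendsto (fun τ ↦ 𝓢.truncDeviationCk B Ψa 2 (Rc τ) τ) atTop (𝓝 0) ∧
  supCkENorm (Subtype.val '' {x : B.domain | τn ≤ t x.1 ∧ R₀ ≤ r x.1 ∧ r x.1 ≤ Rc (t x.1) + 2}) 0
      (𝓢.deviationExtend B Ψa) ≤ ENNReal.ofReal (1 / (10 * ‖(Λ : E4 →L[ℝ] E4)‖ ^ 2)) ∧
  (∀ x : B.domain, τn ≤ t x.1 → R₀ ≤ r x.1 → r x.1 ≤ Rc (t x.1) + 2 →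
    𝓢.timeOrientation.IsFutureDirected (mfderiv 𝓘(ℝ, E4) (𝓡 4) Ψa x (Λ (E4.basisVector 0)))) ∧
  (∀ (τ' : ℝ) (ϱ : ℝ → ℝ), Continuous ϱ → τn < τ' → (∀ s, ϱ s < Rc s + 2) →
    closure (Ψa '' {x | τ' ≤ t x.1 ∧ r x.1 ≤ ϱ (t x.1)}) ∩ O ⊆
      Ψa '' {x | τ' ≤ t x.1 ∧ r x.1 ≤ ϱ (t x.1)}) ∧
  (∀ x : B.domain, τn < t x.1 → r x.1 ≤ 4 * ρ' (x.1 0) →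
    ∃ x' : (d.background i).domain, τ₁ < t₀ x'.1 ∧ r₀ x'.1 < W (x'.1 0) ∧ Ψa x = Ψg x' ∧
      |t₀ x'.1 - t x.1| ≤ κ' (t x.1) * ρ' (x.1 0) ∧ |r₀ x'.1 - r x.1| ≤ κ' (t x.1) * ρ' (x.1 0)) ∧
  (∀ x : B.domain, τn < t x.1 → r x.1 < Rc (t x.1) + 2 → r x.1 ≤ 40 * ρ' (x.1 0))

end Summit.FinalStateConjecture.FinalStateConjecture.Theorems.GapDecaySuffices.Assembly

end
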